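import Mathlib
import HarnessLib.Audit
import Summits.PneNP.PneNP.Theorems.PstarSkeletonSpan

/-!
# The skeleton of a separated part spans it: per-component vertex bounds for terminal cores (ROUND-24, O1; all core sizes; memo g25 §47)

FRONTIER range-avoidance ladder, rung F-N3, ROUND 24 (cell `pnp-ideate`, prover-2 memo `g25/O1-XORSPLIT-g25.md` §47; typed targets
`PstarCoreBoundTargets.TerminalFive` / `TerminalPeelable` (p646951); restricted-model proof complexity — nothing here bears on `P` versus `NP`).

`PstarSkeletonSpan` bounds the XOR vertices of an X-CONNECTED terminal core by its skeleton.  For XOR-disconnected cores (the open case of the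
disconnected analysis, `PstarAdditiveSplit` / `PstarSwitchSplit`) the same holds COMPONENT BY COMPONENT:

* `card_xverts_le_card_succ` (pure combinatorics) — an X-connected family has at most `#E + 1` XOR vertices (the tree bound; no leafless part
  needed);
* `xconnected_skel_part` — inside the core-bound induction, for a SEPARATED part `S` of a terminal core (no member outside `S` has an XOR variable
  among the XOR vertices of `S`) that is X-connected, the skeleton members inside `S` are X-connected on all of `xverts S`;
* `card_xverts_le_card_skel_part` — hence `#xverts S ≤ #(skeleton ∩ S)` when `S` contains a non-empty leafless set of non-chords of `K`, and
  `card_xverts_le_card_skel_part_succ` — `#xverts S ≤ #(skeleton ∩ S) + 1` always.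
-/

set_option linter.dupNamespace false -- `Summit.PneNP.PneNP.…`: summit = sub-problem name (D-0017 single-conjunct layout)

open Finset Literature.Computability.Complexity
open Summit.PneNP.PneNP.Theorems.PstarTyped (Typed)
open Summit.PneNP.PneNP.Theorems.PstarSALevel (varSet bdry BoundaryExpanding SimpleOverlap)
open Summit.PneNP.PneNP.Theorems.PstarXCore (xpair mem_xpair xverts)
open Summit.PneNP.PneNP.Theorems.PstarCoreBound (XorClosed)
open Summit.PneNP.PneNP.Theorems.PstarChordRepair (IsChord)
open Summit.PneNP.PneNP.Theorems.PstarCoreBoundTargets (Terminal)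
open Summit.PneNP.PneNP.Theorems.PstarChordBridgeTools (xpdeg)
open Summit.PneNP.PneNP.Theorems.PstarChordBridgeCotree (exists_leaf_edge)
open Summit.PneNP.PneNP.Theorems.PstarChordBridgeFundamental (sum_xpdeg)
open Summit.PneNP.PneNP.Theorems.PstarChordBridgeExchange (mem_xverts_iff)
open Summit.PneNP.PneNP.Theorems.PstarChordReadOutside (OutsideGated)
open Summit.PneNP.PneNP.Theorems.PstarNoFreeVertex (covered_of_terminal)
open Summit.PneNP.PneNP.Theorems.PstarCleanCut (Crosses CleanCut)
open Summit.PneNP.PneNP.Theorems.PstarCleanCutAssembly (false_of_cleanCut_two)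
open Summit.PneNP.PneNP.Theorems.PstarCleanBridge (not_unique_crossing)
open Summit.PneNP.PneNP.Theorems.PstarSkeletonSpan (XConnected skel mem_skel skel_subset xpdeg_mono xverts_mono xpdeg_pos_of_mem_xverts
  card_xverts_le_card)

namespace Summit.PneNP.PneNP.Theorems.PstarSkeletonParts

variable {n m : ℕ}

/-! ## The tree bound -/

/-- **TREE BOUND.**  An X-connected family has at most `#E + 1` XOR vertices (leaf stripping as in `PstarSkeletonSpan.card_xverts_le_card`,
the leaf case stopping when the stripped member carries both remaining vertices). -/
theorem card_xverts_le_card_succ (I : LocalMap 4 n m) (hI : I.IsPure xorAndPred) :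
    ∀ E : Finset (Fin m), XConnected I E → (xverts I E).card ≤ E.card + 1 := by
  classical
  suffices H : ∀ (k : ℕ) (E : Finset (Fin m)), E.card = k → XConnected I E → (xverts I E).card ≤ E.card + 1 from
    fun E => H _ E rfl
  intro k
  induction k using Nat.strong_induction_on with
  | _ k ih =>
    intro E hk hconn
    have h01 : ∀ j : Fin m, I.vars j 0 ≠ I.vars j 1 := fun j h => absurd (hI.2 j h) (by decide)
    by_cases hleaf : ∃ w ∈ xverts I E, xpdeg I E w = 1
    · -- strip a leaf
      obtain ⟨w, hw, hdeg⟩ := hleaf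
      obtain ⟨e, he, hwe, huniq⟩ := exists_leaf_edge I hdeg
      set E' := E.erase e with hE'
      have hE'E : E' ⊆ E := erase_subset e E
      have hwE' : w ∉ xverts I E' := by
        intro h
        obtain ⟨j, hj, hwj⟩ := (mem_xverts_iff I E' w).1 h
        exact (mem_erase.1 hj).1 (huniq j (mem_of_mem_erase hj) hwj)
      -- the other endpoint `w'` of `e`
      obtain ⟨w', hw'e, hww'⟩ : ∃ w', w' ∈ xpair I e ∧ w' ≠ w := by
        rcases (mem_xpair I).1 hwe with h | h
        · exact ⟨I.vars e 1, (mem_xpair I).2 (Or.inr rfl), fun h' => h01 e (h ▸ h'.symm)⟩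
        · exact ⟨I.vars e 0, (mem_xpair I).2 (Or.inl rfl), fun h' => h01 e (h'.trans h)⟩
      have hpair : ∀ v ∈ xpair I e, v = w ∨ v = w' := by
        intro v hv
        rcases (mem_xpair I).1 hwe with hw0 | hw1 <;> rcases (mem_xpair I).1 hw'e with hw'0 | hw'1 <;>
          rcases (mem_xpair I).1 hv with hv0 | hv1
        · exact absurd (hw'0.trans hw0.symm) hww'
        · exact absurd (hw'0.trans hw0.symm) hww'
        · exact Or.inl (hv0.trans hw0.symm)
        · exact Or.inr (hv1.trans hw'1.symm)
        · exact Or.inr (hv0.trans hw'0.symm)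
        · exact Or.inl (hv1.trans hw1.symm)
        · exact absurd (hw'1.trans hw1.symm) hww'
        · exact absurd (hw'1.trans hw1.symm) hww'
      -- if `{w, w'}` is the whole vertex set we are done; otherwise `w'` survives in `E'`
      have hWsub : ({w, w'} : Finset (Fin n)) ⊆ xverts I E := by
        intro v hv
        rcases mem_insert.1 hv with rfl | hv
        · exact hw
        · rw [mem_singleton.1 hv]; exact (mem_xverts_iff I E _).2 ⟨e, he, hw'e⟩
      by_cases hWeq : ({w, w'} : Finset (Fin n)) = xverts I E
      · rw [← hWeq, card_pair hww'.symm]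
        have : 1 ≤ E.card := card_pos.2 ⟨e, he⟩
        omega
      have hw'E' : w' ∈ xverts I E' := by
        have hWne : ({w, w'} : Finset (Fin n)) ≠ xverts I E := hWeq
        obtain ⟨f, hf, hcr⟩ := hconn {w, w'} hWsub ⟨w, mem_insert_self _ _⟩ hWne
        have hfe : f ≠ e := by
          rintro rfl
          rcases hcr with ⟨h0, h1⟩ | ⟨h0, h1⟩
          · exact h1 (by rcases hpair _ ((mem_xpair I).2 (Or.inr rfl)) with h | h <;> simp [h])
          · exact h0 (by rcases hpair _ ((mem_xpair I).2 (Or.inl rfl)) with h | h <;> simp [h])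
        have hfE' : f ∈ E' := mem_erase.2 ⟨hfe, hf⟩
        have hfw : w ∉ xpair I f := fun h => hfe (huniq f hf h)
        rcases hcr with ⟨h0, -⟩ | ⟨-, h1⟩
        · rw [mem_insert, mem_singleton] at h0
          rcases h0 with h0 | h0
          · exact absurd ((mem_xpair I).2 (Or.inl h0.symm)) hfw
          · exact (mem_xverts_iff I E' _).2 ⟨f, hfE', (mem_xpair I).2 (Or.inl h0.symm)⟩
        · rw [mem_insert, mem_singleton] at h1
          rcases h1 with h1 | h1
          · exact absurd ((mem_xpair I).2 (Or.inr h1.symm)) hfw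
          · exact (mem_xverts_iff I E' _).2 ⟨f, hfE', (mem_xpair I).2 (Or.inr h1.symm)⟩
      -- vertices: `xverts E ⊆ insert w (xverts E')`
      have hV : xverts I E ⊆ insert w (xverts I E') := by
        intro v hv
        obtain ⟨j, hj, hvj⟩ := (mem_xverts_iff I E v).1 hv
        by_cases hje : j = e
        · subst hje
          rcases hpair v hvj with rfl | rfl
          · exact mem_insert_self _ _
          · exact mem_insert_of_mem hw'E'
        · exact mem_insert_of_mem ((mem_xverts_iff I E' v).2 ⟨j, mem_erase.2 ⟨hje, hj⟩, hvj⟩)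
      -- `E'` is X-connected
      have hconn' : XConnected I E' := by
        intro W' hW'sub hW'ne hW'neq
        set W : Finset (Fin n) := if w' ∈ W' then insert w W' else W' with hWdef
        have hWsub : W ⊆ xverts I E := by
          intro v hv
          rw [hWdef] at hv
          by_cases hw'W : w' ∈ W'
          · rw [if_pos hw'W, mem_insert] at hv
            rcases hv with rfl | hv
            · exact hw
            · exact xverts_mono I hE'E (hW'sub hv)
          · rw [if_neg hw'W] at hv
            exact xverts_mono I hE'E (hW'sub hv)
        have hWne : W.Nonempty := by
          obtain ⟨v, hv⟩ := hW'ne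
          refine ⟨v, ?_⟩
          rw [hWdef]
          by_cases hw'W : w' ∈ W'
          · rw [if_pos hw'W]; exact mem_insert_of_mem hv
          · rw [if_neg hw'W]; exact hv
        have hWneq : W ≠ xverts I E := by
          intro hWE
          rw [hWdef] at hWE
          by_cases hw'W : w' ∈ W'
          · rw [if_pos hw'W] at hWE
            apply hW'neq
            refine Subset.antisymm hW'sub fun v hv => ?_
            have hv' : v ∈ insert w W' := hWE ▸ xverts_mono I hE'E hv
            rcases mem_insert.1 hv' with rfl | h
            · exact absurd hv hwE'
            · exact h
          · rw [if_neg hw'W] at hWE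
            exact hwE' (hW'sub (hWE ▸ hw))
        obtain ⟨f, hf, hcr⟩ := hconn W hWsub hWne hWneq
        -- `f ≠ e`: both endpoints of `e` are on the same side of `W`
        have memW : ∀ v, v ≠ w → (v ∈ W ↔ v ∈ W') := by
          intro v hvw
          rw [hWdef]
          by_cases hw'W : w' ∈ W'
          · rw [if_pos hw'W, mem_insert]
            exact ⟨fun h => h.resolve_left hvw, Or.inr⟩
          · rw [if_neg hw'W]
        have hwW : w ∈ W ↔ w' ∈ W' := by
          rw [hWdef]
          by_cases hw'W : w' ∈ W'
          · rw [if_pos hw'W]; exact ⟨fun _ => hw'W, fun _ => mem_insert_self _ _⟩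
          · rw [if_neg hw'W]; exact ⟨fun h => absurd (hW'sub h) hwE', fun h => absurd h hw'W⟩
        have hw'W : w' ∈ W ↔ w' ∈ W' := memW w' hww'
        have hfe : f ≠ e := by
          rintro rfl
          have same : ∀ v ∈ xpair I f, (v ∈ W ↔ w' ∈ W') := by
            intro v hv
            rcases hpair v hv with rfl | rfl
            · exact hwW
            · exact hw'W
          have s0 := same _ ((mem_xpair I).2 (Or.inl rfl))
          have s1 := same _ ((mem_xpair I).2 (Or.inr rfl))
          rcases hcr with ⟨h0, h1⟩ | ⟨h0, h1⟩
          · exact h1 (s1.2 (s0.1 h0))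
          · exact h0 (s0.2 (s1.1 h1))
        have hfw : ∀ s : Fin 4, s = 0 ∨ s = 1 → I.vars f s ≠ w := by
          rintro s hs h
          apply hfe
          refine huniq f hf ((mem_xpair I).2 ?_)
          rcases hs with rfl | rfl
          · exact Or.inl h.symm
          · exact Or.inr h.symm
        refine ⟨f, mem_erase.2 ⟨hfe, hf⟩, ?_⟩
        have m0 := memW _ (hfw 0 (Or.inl rfl))
        have m1 := memW _ (hfw 1 (Or.inr rfl))
        rcases hcr with ⟨h0, h1⟩ | ⟨h0, h1⟩
        · exact Or.inl ⟨m0.1 h0, fun h => h1 (m1.2 h)⟩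
        · exact Or.inr ⟨fun h => h0 (m0.2 h), m1.1 h1⟩
      -- recurse
      have hlt : E'.card < k := by rw [← hk]; exact card_erase_lt_of_mem he
      have ih' := ih E'.card hlt E' rfl hconn'
      have hcardE : E'.card + 1 = E.card := card_erase_add_one he
      calc (xverts I E).card ≤ (insert w (xverts I E')).card := card_le_card hV
        _ ≤ (xverts I E').card + 1 := card_insert_le _ _
        _ ≤ E'.card + 1 + 1 := by omega
        _ = E.card + 1 := by rw [hcardE]
    · -- no leaf: every vertex has slot-degree at least two; handshake
      push Not at hleaf
      have h2 : ∀ w ∈ xverts I E, 2 ≤ xpdeg I E w := by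
        intro w hw
        have := xpdeg_pos_of_mem_xverts I hI hw
        have := hleaf w hw
        omega
      have hsum : 2 * (xverts I E).card ≤ ∑ w, xpdeg I E w := by
        calc 2 * (xverts I E).card = ∑ w ∈ xverts I E, 2 := by rw [sum_const, smul_eq_mul, Nat.mul_comm]
          _ ≤ ∑ w ∈ xverts I E, xpdeg I E w := sum_le_sum h2
          _ ≤ ∑ w, xpdeg I E w := sum_le_sum_of_subset_of_nonneg (subset_univ _) fun _ _ _ => Nat.zero_le _
      rw [sum_xpdeg] at hsum
      omega


/-! ## Separated parts of a terminal core -/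

variable {I : LocalMap 4 n m} {r : ℕ} {y : Fin m → Bool} {K : Finset (Fin m)} {w₁ w₂ : Finset (Fin n) × Finset (Fin m) × Bool}

/-- **The skeleton of an X-connected SEPARATED part is X-connected on the whole part** (inside the induction).  `S ⊆ K` is separated when no
member of `K` outside `S` has an XOR variable among `xverts S` (e.g. a union of XOR-components). -/
theorem xconnected_skel_part (hI : I.IsPure xorAndPred) (hT : Typed I) (hS : SimpleOverlap I) (hB : BoundaryExpanding r I)
    (ht : Terminal I r y K w₁ w₂)
    (hIH : ∀ c ∈ K, ∀ K₀ ⊆ K.erase c, ∀ d d' : Finset (Fin n) × Finset (Fin m) × Bool, Terminal I r y K₀ d d' → K₀.card ≤ 5)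
    {S : Finset (Fin m)} (hSK : S ⊆ K) (hsep : ∀ f ∈ K, f ∉ S → I.vars f 0 ∉ xverts I S ∧ I.vars f 1 ∉ xverts I S) (hconn : XConnected I S) :
    XConnected I (skel I K (w₁.2.1 ∪ w₂.2.1) ∩ S) ∧ xverts I (skel I K (w₁.2.1 ∪ w₂.2.1) ∩ S) = xverts I S := by
  classical
  have hxv : xverts I (skel I K (w₁.2.1 ∪ w₂.2.1) ∩ S) = xverts I S := by
    refine Subset.antisymm (xverts_mono I inter_subset_right) fun u hu => ?_
    obtain ⟨f, hf, huf, hnot⟩ := covered_of_terminal hI hT hS hB ht u (xverts_mono I hSK hu)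
    have hfS : f ∈ S := by
      by_contra hfS
      rcases (mem_xpair I).1 huf with h | h
      · exact (hsep f hf hfS).1 (h ▸ hu)
      · exact (hsep f hf hfS).2 (h ▸ hu)
    exact (mem_xverts_iff I _ u).2 ⟨f, mem_inter.2 ⟨(mem_skel I).2 ⟨hf, hnot⟩, hfS⟩, huf⟩
  refine ⟨fun W hWsub hWne hWneq => ?_, hxv⟩
  rw [hxv] at hWsub hWneq
  obtain ⟨f, hf, hcr⟩ := hconn W hWsub hWne hWneq
  by_contra hno
  push Not at hno
  -- every member of `K` crossing `W` lies in `S` (separation) and is then a clean chord: `W` is a clean cut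
  have hcut : CleanCut I K (w₁.2.1 ∪ w₂.2.1) W := by
    intro g hg hcg
    have hgS : g ∈ S := by
      by_contra hgS
      rcases hcg with ⟨h0, -⟩ | ⟨-, h1⟩
      · exact (hsep g hg hgS).1 (hWsub h0)
      · exact (hsep g hg hgS).2 (hWsub h1)
    by_contra hng
    exact hno g (mem_inter.2 ⟨(mem_skel I).2 ⟨hg, hng⟩, hgS⟩) hcg
  obtain ⟨hch, hO⟩ := hcut f (hSK hf) hcr
  obtain ⟨f', hf', hne, hcr'⟩ := not_unique_crossing hI hT hS hB ht W (hSK hf) hcr hch hO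
  exact false_of_cleanCut_two hI hT hS hB ht hIH hcut (hSK hf) hf' hne.symm hcr hcr'

/-- **`#xverts S ≤ #(skeleton ∩ S)`** for an X-connected separated part `S` containing a non-empty leafless set of non-chords of `K`. -/
theorem card_xverts_le_card_skel_part (hI : I.IsPure xorAndPred) (hT : Typed I) (hS : SimpleOverlap I) (hB : BoundaryExpanding r I)
    (ht : Terminal I r y K w₁ w₂)
    (hIH : ∀ c ∈ K, ∀ K₀ ⊆ K.erase c, ∀ d d' : Finset (Fin n) × Finset (Fin m) × Bool, Terminal I r y K₀ d d' → K₀.card ≤ 5)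
    {S : Finset (Fin m)} (hSK : S ⊆ K) (hsep : ∀ f ∈ K, f ∉ S → I.vars f 0 ∉ xverts I S ∧ I.vars f 1 ∉ xverts I S) (hconn : XConnected I S)
    (hcentre : ∃ S₀ ⊆ S, S₀.Nonempty ∧ (∀ w ∈ xverts I S₀, 2 ≤ xpdeg I S₀ w) ∧ ∀ f ∈ S₀, ¬ IsChord I K f) :
    (xverts I S).card ≤ (skel I K (w₁.2.1 ∪ w₂.2.1) ∩ S).card := by
  obtain ⟨hx, hxv⟩ := xconnected_skel_part hI hT hS hB ht hIH hSK hsep hconn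
  obtain ⟨S₀, hS₀, hne, hL, hnc⟩ := hcentre
  rw [← hxv]
  exact card_xverts_le_card I hI _ hx
    ⟨S₀, fun f hf => mem_inter.2 ⟨(mem_skel I).2 ⟨hSK (hS₀ hf), fun h => hnc f hf h.1⟩, hS₀ hf⟩, hne, hL⟩

/-- **`#xverts S ≤ #(skeleton ∩ S) + 1`** for every X-connected separated part `S` (tree bound). -/
theorem card_xverts_le_card_skel_part_succ (hI : I.IsPure xorAndPred) (hT : Typed I) (hS : SimpleOverlap I) (hB : BoundaryExpanding r I)
    (ht : Terminal I r y K w₁ w₂)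
    (hIH : ∀ c ∈ K, ∀ K₀ ⊆ K.erase c, ∀ d d' : Finset (Fin n) × Finset (Fin m) × Bool, Terminal I r y K₀ d d' → K₀.card ≤ 5)
    {S : Finset (Fin m)} (hSK : S ⊆ K) (hsep : ∀ f ∈ K, f ∉ S → I.vars f 0 ∉ xverts I S ∧ I.vars f 1 ∉ xverts I S) (hconn : XConnected I S) :
    (xverts I S).card ≤ (skel I K (w₁.2.1 ∪ w₂.2.1) ∩ S).card + 1 := by
  obtain ⟨hx, hxv⟩ := xconnected_skel_part hI hT hS hB ht hIH hSK hsep hconn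
  rw [← hxv]
  exact card_xverts_le_card_succ I hI _ hx

end Summit.PneNP.PneNP.Theorems.PstarSkeletonParts
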